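import Summits.QuantumFields.YangMills.Theorems.ConvexGribovBodyNonSimplyConnectedLatticeGapStubLargeFieldSparseExplicit
import Summits.QuantumFields.YangMills.Theorems.ConvexGribovBodyNonSimplyConnectedLatticeGapStubChainChessboardOfLargeFieldSparse
import Summits.QuantumFields.YangMills.Theorems.ConvexGribovBodyNonSimplyConnectedLatticeGapStubLongBadChainsRareOfChessboard
import Summits.QuantumFields.YangMills.Theorems.ParabolicTrajectoryLatticeGapOnTrajectoryLargeFieldSparse
import HarnessLib

/-!
# Crux `NonSimplyConnectedLatticeGap` (stmt-QuantumFields-16405), line `Sketch`: the chessboard / Peierls half (P1)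
# of the line, UNCONDITIONALLY — long chains of bad plaquettes are exponentially rare under Wilson's torus measures
# at large `β`, for every compact gauge group

The line `Sketch` (skeleton `Cruxes/NonSimplyConnectedLatticeGap/Lines/Sketch.lean`, v15) reduces the crux to two inputs:
P1 (rarity of long bad chains in the shell around a cube, under the torus Wilson states at large `β`) and P2 (weak mixing on
cubes uniformly over good exterior data — the open core). This file assembles P1 from the landed stubs, with no hypothesis left:

* `largeFieldSparse_explicit` — large-field sparseness on the odd torus `(ℤ/(2S+1))⁴` with the explicit threshold `S ≥ 1`
  (LFS `stub_largeFieldSparse_explicit` p140796 applied to the unconditional four-direction tilt chessboard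
  `…SparseDefectOrbitWindow.tiltChessboard` of crux `LatticeGapOnTrajectory`): for every `ε₀ > 0` there are `c > 0`, `b₀` with
  `μ_{β,2S+1}(every p ∈ X is ε₀-large) ≤ exp(−c β |X|)` for all `β ≥ b₀`, `S ≥ 1`, all plaquette sets `X`
  (Bałaban's large-field suppression in chessboard form; Fröhlich–Israel–Lieb–Simon on the odd torus with exponential tilts).
* `chainChessboardBound` — CHESS: for `a > 0` and any `q > 0` there is `β₃` such that for `β ≥ β₃` a fixed injective chain of
  `k + 1` plaquettes of `ℤ⁴` in the injecting window `‖x‖∞ + 1 ≤ S` is entirely `a`-bad on the periodic lift with torus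
  probability `≤ q^{k+1}` (BRIDGE `stub_chainChessboard_of_largeFieldSparse` p140776).
* `longBadChainsRare` — P1: for `a > 0` there is `β₃` such that for `β ≥ β₃` there are `c > 0`, `C` with
  `μ_{β,2S+1}(torusLift V ∉ goodExterior ρ a L) ≤ C e^{−cL}` whenever `2L + 1 ≤ S` (RED `stub_longBadChainsRare_of_chessboard`
  p135694: Peierls counting and summation).

With P1 in the tree, the crux is reduced to P2 alone (`Theorems/ConvexGribovBodyNonSimplyConnectedLatticeGapOfGoodExteriorMixing.lean`).
-/

set_option autoImplicit false

namespace Summit.QuantumFields.YangMills.Theorems.NonSimplyConnectedLatticeGap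

/-- **Large-field sparseness on odd four-tori, explicit threshold `S ≥ 1`, every compact `G`**: for every faithful continuous
unitary lattice representation `r` and every `ε₀ > 0` there are `c > 0`, `b₀` such that for all `β ≥ b₀`, all `S ≥ 1` and all finite
plaquette sets `X` of `(ℤ/(2S+1))⁴`, the Wilson probability that every plaquette of `X` has `N − Re tr r(U_p) ≥ ε₀` is at most
`exp(−c β |X|)` (LFS applied to the unconditional tilt chessboard of crux `LatticeGapOnTrajectory`). -/
theorem largeFieldSparse_explicit : ∀ (G : Type) [Group G] [TopologicalSpace G] [IsTopologicalGroup G] [CompactSpace G] [MeasurableSpace G] [BorelSpace G] (r : Literature.MathematicalPhysics.QuantumFieldTheory.LatticeRep G) (ε₀ : ℝ), 0 < ε₀ → ∃ (c b₀ : ℝ), 0 < c ∧ ∀ β : ℝ, b₀ ≤ β → ∀ S : ℕ, 1 ≤ S → ∀ X : Finset (Literature.MathematicalPhysics.QuantumFieldTheory.Plaquette 4 (2 * S + 1)), (Literature.MathematicalPhysics.QuantumFieldTheory.wilsonMeasure r.ρ β : MeasureTheory.Measure (Literature.MathematicalPhysics.QuantumFieldTheory.GaugeConfig 4 (2 * S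 + 1) G)) {U | ∀ p ∈ X, ε₀ ≤ (r.N : ℝ) - (r.ρ (Literature.MathematicalPhysics.QuantumFieldTheory.plaquetteHolonomy U p.1 p.2.1.1 p.2.1.2)).trace.re} ≤ ENNReal.ofReal (Real.exp (-(c * β * X.card))) :=
  stub_largeFieldSparse_explicit
    Summit.QuantumFields.YangMills.Cruxes.LatticeGapOnTrajectory.SparseDefectOrbitWindow.tiltChessboard

/-- **CHESS — chessboard bound for simple bad chains on the odd torus at large `β`** (unconditional): at large `β` the torus
probability that a fixed injective chain of `k+1` plaquettes of `ℤ⁴` (base points in the injecting window `‖x‖∞ + 1 ≤ S`) is entirely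
`a`-bad on the periodic lift is `≤ q^{k+1}`, with `q > 0` as small as desired. -/
theorem chainChessboardBound : ∀ (G : Type) [Group G] [TopologicalSpace G] [IsTopologicalGroup G] [CompactSpace G] [MeasurableSpace G] [BorelSpace G], Literature.MathematicalPhysics.QuantumFieldTheory.IsCompactSimpleLieGroup G → ∀ r : Literature.MathematicalPhysics.QuantumFieldTheory.LatticeRep G, ∀ a : ℝ, 0 < a → ∀ q : ℝ, 0 < q → ∃ β₃ : ℝ, ∀ β : ℝ, β₃ ≤ β → ∀ (S k : ℕ) (c : Fin (k + 1) → Literature.MathematicalPhysics.QuantumLattice.ZdPlaquette 4), Function.Injective c → (∀ i, Summit.QuantumFields.YangMills.Cruxes.NonSimplyConnectedLatticeGap.Sketch.siteSupNorm (c i).1 + 1 ≤ S) → ((Literature.MathematicalPhysics.QuantumFieldTheory.wilsonMeasure r.ρ β : MeasureTheory.Measure (Literature.MathematicalPhysics.QuantumFieldTheory.GaugeConfig 4 (2 * S + 1) G)) {V | ∀ i, Summit.QuantumFields.YangMills.Cruxes.NonSimplyConnectedLatticeGap.Sketch.IsBadPlaquette r.ρ a (Literature.MathematicalPhysics.QuantumLattice.torusLift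 (2 * S + 1) V) (c i)}).toReal ≤ q ^ (k + 1) :=
  stub_chainChessboard_of_largeFieldSparse largeFieldSparse_explicit

/-- **P1 — long bad chains are rare under the torus Wilson states at large `β`** (unconditional; every compact simple `G`,
every lattice representation): for `a > 0` there is `β₃` such that for all `β ≥ β₃` there are `c > 0` and `C` with
`μ_{β,2S+1}(torusLift (2S+1) V ∉ goodExterior r.ρ a L) ≤ C e^{−cL}` for all `L`, `S` with `2L + 1 ≤ S` (Peierls bound: CHESS with
`q ≤ 1/7500`, chain counting `≤ 3750^k`, union over starts in the shell). -/
theorem longBadChainsRare : ∀ (G : Type) [Group G] [TopologicalSpace G] [IsTopologicalGroup G] [CompactSpace G] [MeasurableSpace G] [BorelSpace G], Literature.MathematicalPhysics.QuantumFieldTheory.IsCompactSimpleLieGroup G → ∀ r : Literature.MathematicalPhysics.QuantumFieldTheory.LatticeRep G, ∀ a : ℝ, 0 < a → ∃ β₃ : ℝ, ∀ β : ℝ, β₃ ≤ β → ∃ c : ℝ, 0 < c ∧ ∃ C : ℝ, ∀ (L S : ℕ), 2 * L + 1 ≤ S → ((Literature.MathematicalPhysics.QuantumFieldTheory.wilsonMeasure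 r.ρ β : MeasureTheory.Measure (Literature.MathematicalPhysics.QuantumFieldTheory.GaugeConfig 4 (2 * S + 1) G)) {V | Literature.MathematicalPhysics.QuantumLattice.torusLift (2 * S + 1) V ∉ Summit.QuantumFields.YangMills.Cruxes.NonSimplyConnectedLatticeGap.Sketch.goodExterior r.ρ a L}).toReal ≤ C * Real.exp (-(c * L)) :=
  stub_longBadChainsRare_of_chessboard chainChessboardBound

end Summit.QuantumFields.YangMills.Theorems.NonSimplyConnectedLatticeGap
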